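/-
Copyright (c) 2026. All rights reserved.
Released under Apache 2.0 license as described in the file LICENSE.
Authors: abc-iut cell, IUT REPAIR / RESCUE-H prover seat abc-iut-rp-d4 (gen 3).
-/
import Literature.IUT.LogVolume.UnitLogValuationProfileShell
import HarnessLib

/-!
# The VALUATION PROFILE of `log_p(𝒪_K^×)`, III: TIE levels — when `−p` is not a `(p−1)`-th power to first order
# (no `ζ_p` in `K`) the two tying terms never cancel, and the whole profile of parts I–II survives `(p − 1) ∣ e`

PROOF-ONLY sequel (no `def`, no named fact) of `UnitLogValuationProfile{,Shell}.lean` (abc-iut cell, D-0079 RESCUE-H, R-H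
lead's RE-ARM row «rp-d4 → … valuation profile of `log 𝒪^×_{K_w}` at deep `w`, e ≥ p, WITH/WITHOUT ζ_p»).  Setting as there:
`K` a proper ultrametric normed `ℚ_p`-algebra, `e = absRamificationIdx p K`, `ϖ` a norm uniformizer, `L = logUnits K`,
`h_s(a) = s·pᵃ − e·a` the exponent of the term of index `pᵃ` of `L(y)` when `‖1 − y‖ = ‖ϖ‖ˢ`.

THE POINT.  Parts I–II assumed `(p − 1) ∤ e`, which excludes every TIE `e = s·p^{a₀}·(p−1)` (two consecutive prime-power
terms of `L(y)` of the same norm).  At a tie the norm of `L(y)` is still the common value `‖ϖ‖^{h_s(a₀)}` UNLESS the two terms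
cancel to first order; their ratio is the unit `x^{p^{a₀}(p−1)}/p` (`x = 1 − y`), so cancellation means `‖X^{p−1} + p‖ < ‖p‖`
for `X = x^{p^{a₀}}` — i.e. `−p` IS a `(p−1)`-th power to first order, which at the boundary `e = p − 1` is EXACTLY
«`K` contains a primitive `p`-th root of unity» (tree: abc-iut-w6-d060
`BoundaryRamification.exists_pow_prime_eq_one_ne_one_iff_exists_norm_pow_add_lt`; classically `ℚ_p(ζ_p) = ℚ_p((−p)^{1/(p−1)})`).
Under the first-order hypothesis **(NZ) `∀ X : K, ‖p‖ ≤ ‖X^{p−1} + p‖`** («no `ζ_p` to first order»):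

* §1 tie arithmetic: at a tie the exponents other than `h(a₀) = h(a₀+1)` are `≥ h(a₀) + 1` (`exponent_lower_of_tie`).
* §2 `norm_logSeries_eq_zpow_of_two_dominant` — ultrametric read-out with TWO designated terms.
* §3 `norm_add_eq_of_tie` — under (NZ) the two tying terms have sum of norm exactly `‖ϖ‖^{h(a₀)}`.
* §4 **`norm_logSeries_eq_zpow_of_tie`**, and the uniform statement **`norm_logSeries_eq_zpow_of_turning`**: under (NZ),
  for EVERY `s` and its (non-strict) turning point `a₀`, `‖L(y)‖ = ‖ϖ‖^{h_s(a₀)}` — tie or not.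
* §5 consequences under (NZ), every `e`: `exists_norm_unitLog_eq_zpow_of_turning` (every non-zero log-unit has norm
  `‖ϖ‖^{ν(s)}`, `ν(s) = h_s(a₀(s))`), `norm_unitLog_one_sub_pow_of_turning` (attained), the GAP theorem
  `norm_ne_zpow_of_mem_logUnits_of_gap'` and the cell form `not_mem_pow_smul_logShell_of_gap'` — the DECIDED-NEG gap cells on
  the `(p−1) ∣ e_w` rows (e.g. `6 ∣ e_w` at `p = 7`) ABOVE the first tie level, complementing abc-iut-rp-x2's below-tie theorem.

Not here: the boundary BALL `𝔪^{e/(p−1)} ⊆ L` under (NZ) (volume argument; sequel), and the `ζ_p ∈ K` profile (cancellation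
cosets).  Classical `p`-adic analysis (Neukirch ANT II (5.5)–(5.7); Washington Lemma 1.4); nothing disputed; no IUT statement
asserted; no side taken on [IUTchIII] Cor. 3.12 or on any author.
References: [cite: NeukirchANT1999, Ch. II Prop. (5.5), (5.7)] [cite: Washington1997, Lemma 1.4, §5.1] [cite: Koblitz1984, Ch. IV §1–2].
-/

noncomputable section

open Metric Set
open scoped Pointwise

namespace Literature.IUT.LogVolume

namespace ValuationProfile

open Literature.NumberTheory.GaloisRepresentations.Ultrametric RamificationCriterion
  Literature.AnabelianGeometry.AbsoluteAnabelian

/-! ### §1. Arithmetic of a tie -/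

section Arith

variable (p : ℕ) [hp : Fact p.Prime]

/-- **At a tie every other exponent is larger by `≥ 1`.**  If `s·pᵃ·(p−1) < E` for `a < a₀` and `E = s·p^{a₀}·(p−1)` (tie:
`h(a₀) = h(a₀+1)`), then `h(a₀) + 1 ≤ h(a)` for every `a ∉ {a₀, a₀+1}` (strict decrease before `a₀`, `exponent_add_le`; after
`a₀ + 1` the increment is `E·p − E ≥ 1` and increments grow). [cite: NeukirchANT1999, Ch. II Prop. (5.5)] -/
theorem exponent_lower_of_tie {s E : ℤ} (hs : 1 ≤ s) (hE : 1 ≤ E) {a₀ : ℕ}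
    (hlo : ∀ a < a₀, s * (p : ℤ) ^ a * ((p : ℤ) - 1) < E) (htie : E = s * (p : ℤ) ^ a₀ * ((p : ℤ) - 1))
    {a : ℕ} (ha : a ≠ a₀) (ha' : a ≠ a₀ + 1) :
    s * (p : ℤ) ^ a₀ - E * (a₀ : ℤ) + 1 ≤ s * (p : ℤ) ^ a - E * (a : ℤ) := by
  have hP : (2 : ℤ) ≤ (p : ℤ) := by exact_mod_cast hp.out.two_le
  rcases Nat.lt_or_ge a a₀ with hlt | hge
  · obtain ⟨d, rfl⟩ := Nat.exists_eq_add_of_lt hlt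
    have h := exponent_add_le hlo (d + 1) a (by omega)
    push_cast at h ⊢
    linarith
  · obtain ⟨d, rfl⟩ : ∃ d, a = a₀ + 2 + d := ⟨a - (a₀ + 2), by omega⟩
    -- `h(a₀+1) = h(a₀)`, `h(a₀+2) = h(a₀+1) + (E·p − E)`, then non-decreasing
    have h01 := exponent_succ_sub s (p : ℤ) E a₀
    have h12 := exponent_succ_sub s (p : ℤ) E (a₀ + 1)
    have hhi2 : E ≤ s * (p : ℤ) ^ (a₀ + 1) * ((p : ℤ) - 1) := by
      rw [htie, pow_succ]
      have : 0 ≤ s * (p : ℤ) ^ a₀ * ((p : ℤ) - 1) := by rw [← htie]; linarith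
      nlinarith
    have hrest := exponent_succ_le_add (a₀ := a₀ + 1) hs hP hhi2 d
    have hinc : s * (p : ℤ) ^ (a₀ + 1) * ((p : ℤ) - 1) - E = E * (p : ℤ) - E := by
      rw [htie]; ring
    have hEp : E ≤ E * (p : ℤ) - E := by nlinarith
    rw [show a₀ + 2 + d = a₀ + 1 + d + 1 from by ring]
    push_cast at h01 h12 hrest ⊢
    nlinarith [h01, h12, hrest, hinc, hEp]

/-- Ties force `(p − 1) ∣ e`; so on the rows with `(p−1) ∤ e` parts I–II already apply. [cite: NeukirchANT1999, Ch. II Prop. (5.5)] -/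
theorem dvd_of_tie {e : ℕ} {s : ℤ} {a₀ : ℕ} (htie : (e : ℤ) = s * (p : ℤ) ^ a₀ * ((p : ℤ) - 1)) : (p - 1) ∣ e := by
  by_contra hnd
  exact natCast_ne_turning_of_not_dvd p hnd s a₀ htie

end Arith

/-! ### §2. Ultrametric read-out with two designated terms -/

section Analytic

variable (p : ℕ) [hp : Fact p.Prime]
variable {K : Type*} [NontriviallyNormedField K] [instK : NormedAlgebra ℚ_[p] K] [IsUltrametricDist K]
  [ProperSpace K]

/-- **Two dominant terms decide the norm.**  If the terms of indices `n₀ + 1 ≠ n₁ + 1` of `L(y)` have SUM of norm `‖ϖ‖^{N₀}`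
and every other term has exponent `≥ N₀ + 1`, then `‖L(y)‖ = ‖ϖ‖^{N₀}` (`y` principal). [cite: NeukirchANT1999, Ch. II Prop. (5.5)] -/
theorem norm_logSeries_eq_zpow_of_two_dominant {ϖ : Kˣ} (hϖ : IsUniformizer ϖ) {y : K} (hyP : IsPrincipal y)
    {s : ℤ} (hy : ‖1 - y‖ = ‖(ϖ : K)‖ ^ s) {n₀ n₁ : ℕ} (hne : n₀ ≠ n₁) {N₀ : ℤ}
    (h₀₁ : ‖-((1 - y) ^ (n₀ + 1)) / (n₀ + 1 : K) + -((1 - y) ^ (n₁ + 1)) / (n₁ + 1 : K)‖ = ‖(ϖ : K)‖ ^ N₀)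
    (h : ∀ n : ℕ, n ≠ n₀ → n ≠ n₁ →
      N₀ + 1 ≤ s * ((n + 1 : ℕ) : ℤ) - (absRamificationIdx p K : ℤ) * (padicValNat p (n + 1) : ℤ)) :
    ‖logSeries y‖ = ‖(ϖ : K)‖ ^ N₀ := by
  classical
  have hρ0 : 0 < ‖(ϖ : K)‖ := norm_units_pos ϖ
  set f : ℕ → K := fun n ↦ -((1 - y) ^ (n + 1)) / (n + 1 : K) with hf
  have hsum : HasSum f (logSeries y) := hasSum_logSeries p hyP
  have hsum₁ : HasSum (fun n ↦ if n = n₀ then 0 else f n) (logSeries y - f n₀) := hasSum_ite_sub_hasSum hsum n₀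
  have hsum₂ : HasSum (fun n ↦ if n = n₁ then 0 else (if n = n₀ then 0 else f n))
      ((logSeries y - f n₀) - (if n₁ = n₀ then 0 else f n₁)) := hasSum_ite_sub_hasSum hsum₁ n₁
  rw [if_neg (Ne.symm hne)] at hsum₂
  have hterm : ∀ n, ‖f n‖ = ‖(ϖ : K)‖ ^
      (s * ((n + 1 : ℕ) : ℤ) - (absRamificationIdx p K : ℤ) * (padicValNat p (n + 1) : ℤ)) :=
    fun n ↦ norm_logTerm_eq_zpow p hϖ hy n
  have hrest : ‖logSeries y - f n₀ - f n₁‖ ≤ ‖(ϖ : K)‖ ^ (N₀ + 1) := by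
    rw [← hsum₂.tsum_eq]
    refine IsUltrametricDist.norm_tsum_le_of_forall_le_of_nonneg (zpow_pos hρ0 _).le fun n ↦ ?_
    by_cases hn1 : n = n₁
    · rw [if_pos hn1, norm_zero]; exact (zpow_pos hρ0 _).le
    by_cases hn0 : n = n₀
    · rw [if_neg hn1, if_pos hn0, norm_zero]; exact (zpow_pos hρ0 _).le
    rw [if_neg hn1, if_neg hn0, hterm n]
    exact zpow_le_zpow_right_of_le_one₀ hρ0 hϖ.1.le (h n hn0 hn1)
  have hmain : ‖f n₀ + f n₁‖ = ‖(ϖ : K)‖ ^ N₀ := h₀₁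
  have hlt : ‖logSeries y - f n₀ - f n₁‖ < ‖f n₀ + f n₁‖ := by
    rw [hmain]
    exact hrest.trans_lt (zpow_lt_zpow_right_of_lt_one₀ hρ0 hϖ.1 (lt_add_one N₀))
  have hsplit : logSeries y = (f n₀ + f n₁) + (logSeries y - f n₀ - f n₁) := by ring
  rw [hsplit, IsUltrametricDist.norm_add_eq_max_of_norm_ne_norm (ne_of_gt hlt), max_eq_left hlt.le, hmain]

/-! ### §3. Under (NZ) the two tying terms do not cancel -/

/-- **The ratio of the tying terms is the unit `x^{p^{a₀}(p−1)}/p`** (`x = 1 − y`, `‖x‖ = ‖ϖ‖ˢ`, tie `e = s·p^{a₀}·(p−1)`):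
its norm is `‖ϖ‖^{s·p^{a₀}(p−1) − e} = 1`. [cite: NeukirchANT1999, Ch. II Prop. (5.5)] -/
theorem norm_pow_div_prime_eq_one_of_tie {ϖ : Kˣ} (hϖ : IsUniformizer ϖ) {x : K} {s : ℤ} (hx : ‖x‖ = ‖(ϖ : K)‖ ^ s)
    {a₀ : ℕ} (htie : (absRamificationIdx p K : ℤ) = s * (p : ℤ) ^ a₀ * ((p : ℤ) - 1)) :
    ‖x ^ (p ^ a₀ * (p - 1)) / (p : K)‖ = 1 := by
  have hρ0 : 0 < ‖(ϖ : K)‖ := norm_units_pos ϖ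
  have hρ : ‖(ϖ : K)‖ ≠ 0 := hρ0.ne'
  have hcast : ((p ^ a₀ * (p - 1) : ℕ) : ℤ) = (p : ℤ) ^ a₀ * ((p : ℤ) - 1) := by
    rw [Nat.cast_mul, Nat.cast_pow, Nat.cast_sub hp.out.one_le, Nat.cast_one]
  rw [norm_div, norm_pow, hx, norm_prime_eq_norm_pow p K hϖ, ← zpow_natCast, ← zpow_natCast, ← zpow_mul, hcast,
    div_eq_iff (zpow_ne_zero _ hρ), one_mul, htie]
  congr 1
  ring

/-- **(NZ) ⟹ no cancellation**: if `‖p‖ ≤ ‖X^{p−1} + p‖` for every `X`, then for the unit `u = x^{p^{a₀}(p−1)}/p` of a tie,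
`‖1 + u‖ = 1` (else `X := x^{p^{a₀}}` would violate (NZ)). [cite: Washington1997, Lemma 1.4, §5.1] -/
theorem norm_one_add_pow_div_eq_one_of_noZeta (hNZ : ∀ X : K, ‖(p : K)‖ ≤ ‖X ^ (p - 1) + (p : K)‖) {ϖ : Kˣ}
    (hϖ : IsUniformizer ϖ) {x : K} {s : ℤ} (hx : ‖x‖ = ‖(ϖ : K)‖ ^ s) {a₀ : ℕ}
    (htie : (absRamificationIdx p K : ℤ) = s * (p : ℤ) ^ a₀ * ((p : ℤ) - 1)) :
    ‖1 + x ^ (p ^ a₀ * (p - 1)) / (p : K)‖ = 1 := by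
  have hu := norm_pow_div_prime_eq_one_of_tie p hϖ hx htie
  have hp0 : (p : K) ≠ 0 := by
    haveI := Literature.NumberTheory.Transcendental.IwasawaLog.charZero p (F := K)
    exact_mod_cast hp.out.ne_zero
  have hpn : 0 < ‖(p : K)‖ := norm_pos_iff.mpr hp0
  -- `‖1 + u‖ ≤ 1` by the ultrametric inequality; if `< 1` then `‖X^{p-1} + p‖ = ‖p‖·‖u + 1‖ < ‖p‖`
  have hle : ‖1 + x ^ (p ^ a₀ * (p - 1)) / (p : K)‖ ≤ 1 := by
    refine (IsUltrametricDist.norm_add_le_max _ _).trans ?_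
    rw [norm_one, hu, max_self]
  refine le_antisymm hle (not_lt.mp fun hlt ↦ ?_)
  have hX := hNZ (x ^ p ^ a₀)
  have hid : (x ^ p ^ a₀) ^ (p - 1) + (p : K) = (p : K) * (1 + x ^ (p ^ a₀ * (p - 1)) / (p : K)) := by
    rw [← pow_mul]
    field_simp
    ring
  rw [hid, norm_mul] at hX
  have : ‖(p : K)‖ * ‖1 + x ^ (p ^ a₀ * (p - 1)) / (p : K)‖ < ‖(p : K)‖ * 1 := mul_lt_mul_of_pos_left hlt hpn
  rw [mul_one] at this
  exact absurd hX (not_le.mpr this)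

/-- **Sum of the two tying terms.**  With `x = 1 − y`, `‖x‖ = ‖ϖ‖ˢ`, tie at `a₀` and (NZ): the terms of indices `p^{a₀}` and
`p^{a₀+1}` of `L(y)` sum to an element of norm EXACTLY `‖ϖ‖^{s·p^{a₀} − e·a₀}` — the sum is the first term times `1 + u`.
[cite: NeukirchANT1999, Ch. II Prop. (5.5)] [cite: Washington1997, Lemma 1.4, §5.1] -/
theorem norm_add_eq_of_tie (hNZ : ∀ X : K, ‖(p : K)‖ ≤ ‖X ^ (p - 1) + (p : K)‖) {ϖ : Kˣ} (hϖ : IsUniformizer ϖ)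
    {y : K} {s : ℤ} (hy : ‖1 - y‖ = ‖(ϖ : K)‖ ^ s) {a₀ : ℕ}
    (htie : (absRamificationIdx p K : ℤ) = s * (p : ℤ) ^ a₀ * ((p : ℤ) - 1)) {n₀ n₁ : ℕ} (hn₀ : n₀ + 1 = p ^ a₀)
    (hn₁ : n₁ + 1 = p ^ (a₀ + 1)) :
    ‖-((1 - y) ^ (n₀ + 1)) / (n₀ + 1 : K) + -((1 - y) ^ (n₁ + 1)) / (n₁ + 1 : K)‖ =
      ‖(ϖ : K)‖ ^ (s * (p : ℤ) ^ a₀ - (absRamificationIdx p K : ℤ) * (a₀ : ℤ)) := by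
  haveI := Literature.NumberTheory.Transcendental.IwasawaLog.charZero p (F := K)
  have hp0 : (p : K) ≠ 0 := by exact_mod_cast hp.out.ne_zero
  have hpa0 : ((p : K) ^ a₀) ≠ 0 := pow_ne_zero _ hp0
  set x : K := 1 - y with hxdef
  -- the first term and its norm
  have hT₀ : ‖-((1 - y) ^ (n₀ + 1)) / (n₀ + 1 : K)‖ =
      ‖(ϖ : K)‖ ^ (s * (p : ℤ) ^ a₀ - (absRamificationIdx p K : ℤ) * (a₀ : ℤ)) := by
    rw [norm_logTerm_eq_zpow p hϖ hy n₀, hn₀, padicValNat.prime_pow]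
    push_cast
    ring_nf
  -- factorisation: `T₀ + T₁ = T₀ · (1 + x^{p^{a₀}(p-1)}/p)`
  have hcast₀ : ((n₀ : K) + 1) = (p : K) ^ a₀ := by exact_mod_cast hn₀
  have hcast₁ : ((n₁ : K) + 1) = (p : K) ^ (a₀ + 1) := by exact_mod_cast hn₁
  have hp1 : 1 ≤ p := hp.out.one_le
  have hfac : -((1 - y) ^ (n₀ + 1)) / (n₀ + 1 : K) + -((1 - y) ^ (n₁ + 1)) / (n₁ + 1 : K) =
      (-((1 - y) ^ (n₀ + 1)) / (n₀ + 1 : K)) * (1 + x ^ (p ^ a₀ * (p - 1)) / (p : K)) := by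
    rw [hcast₀, hcast₁, hn₀, hn₁, ← hxdef]
    have hexp : p ^ (a₀ + 1) = p ^ a₀ * (p - 1) + p ^ a₀ := by
      rw [pow_succ, ← Nat.mul_add_one, Nat.sub_add_cancel hp1]
    rw [hexp, pow_add, pow_succ, pow_mul]
    field_simp
    ring
  rw [hfac, norm_mul, norm_one_add_pow_div_eq_one_of_noZeta p hNZ hϖ (by rw [hxdef, hy]) htie, mul_one, hT₀]

/-! ### §4. Exact norm at a tie, and the uniform statement -/

/-- **Exact norm at a TIE under (NZ).**  `‖1 − y‖ = ‖ϖ‖ˢ`, `s·pᵃ·(p−1) < e` for `a < a₀`, `e = s·p^{a₀}·(p−1)`, and (NZ)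
⟹ `‖L(y)‖ = ‖ϖ‖^{s·p^{a₀} − e·a₀}`. [cite: NeukirchANT1999, Ch. II Prop. (5.5)] [cite: Washington1997, Lemma 1.4, §5.1] -/
theorem norm_logSeries_eq_zpow_of_tie (hNZ : ∀ X : K, ‖(p : K)‖ ≤ ‖X ^ (p - 1) + (p : K)‖) {ϖ : Kˣ}
    (hϖ : IsUniformizer ϖ) {y : K} (hyP : IsPrincipal y) {s : ℤ} (hy : ‖1 - y‖ = ‖(ϖ : K)‖ ^ s) {a₀ : ℕ}
    (hlo : ∀ a < a₀, s * (p : ℤ) ^ a * ((p : ℤ) - 1) < absRamificationIdx p K)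
    (htie : (absRamificationIdx p K : ℤ) = s * (p : ℤ) ^ a₀ * ((p : ℤ) - 1)) :
    ‖logSeries y‖ = ‖(ϖ : K)‖ ^ (s * (p : ℤ) ^ a₀ - (absRamificationIdx p K : ℤ) * (a₀ : ℤ)) := by
  classical
  have hρ0 : 0 < ‖(ϖ : K)‖ := norm_units_pos ϖ
  have hs1 : 1 ≤ s := by
    have h1 : ‖(ϖ : K)‖ ^ s < 1 := hy ▸ hyP
    have := (zpow_lt_one_iff_right_of_lt_one₀ hρ0 hϖ.1).mp h1
    omega
  have hE : (1 : ℤ) ≤ (absRamificationIdx p K : ℤ) := by exact_mod_cast absRamificationIdx_pos p K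
  obtain ⟨n₀, hn₀⟩ : ∃ n₀ : ℕ, n₀ + 1 = p ^ a₀ := ⟨p ^ a₀ - 1, Nat.sub_add_cancel (Nat.one_le_pow _ _ hp.out.pos)⟩
  obtain ⟨n₁, hn₁⟩ : ∃ n₁ : ℕ, n₁ + 1 = p ^ (a₀ + 1) :=
    ⟨p ^ (a₀ + 1) - 1, Nat.sub_add_cancel (Nat.one_le_pow _ _ hp.out.pos)⟩
  have hne : n₀ ≠ n₁ := by
    intro h
    have : p ^ a₀ = p ^ (a₀ + 1) := by rw [← hn₀, ← hn₁, h]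
    exact absurd (Nat.pow_right_injective hp.out.two_le this) (by omega)
  refine norm_logSeries_eq_zpow_of_two_dominant p hϖ hyP hy hne (norm_add_eq_of_tie p hNZ hϖ hy htie hn₀ hn₁) ?_
  intro n hn0 hn1
  obtain ⟨a, ha, ha'⟩ := exists_exponent_le_index (p := p) hs1 (absRamificationIdx p K) (Nat.succ_ne_zero n)
  by_cases haa : a = a₀
  · have hne' : n + 1 ≠ p ^ a := by rw [haa, ← hn₀]; intro h; exact hn0 (by omega)
    have := ha' hne'
    rw [haa] at this
    exact this
  by_cases haa' : a = a₀ + 1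
  · have hne' : n + 1 ≠ p ^ a := by rw [haa', ← hn₁]; intro h; exact hn1 (by omega)
    have h2 := ha' hne'
    -- `h(a₀+1) = h(a₀)`
    have h01 := exponent_succ_sub s (p : ℤ) (absRamificationIdx p K : ℤ) a₀
    rw [haa'] at h2
    have : s * (p : ℤ) ^ a₀ * ((p : ℤ) - 1) - (absRamificationIdx p K : ℤ) = 0 := by rw [htie]; ring
    push_cast at h01 h2 ⊢
    linarith
  · exact (exponent_lower_of_tie p hs1 hE hlo htie haa haa').trans ha

/-- **THE UNIFORM STATEMENT under (NZ).**  For `‖1 − y‖ = ‖ϖ‖ˢ` and the (non-strict) turning point `a₀` of `s`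
(`s·pᵃ·(p−1) < e` for `a < a₀`, `e ≤ s·p^{a₀}·(p−1)`): `‖L(y)‖ = ‖ϖ‖^{s·p^{a₀} − e·a₀}` — by part I if the inequality is
strict, by `norm_logSeries_eq_zpow_of_tie` if it is a tie. [cite: NeukirchANT1999, Ch. II Prop. (5.5)] -/
theorem norm_logSeries_eq_zpow_of_turning (hNZ : ∀ X : K, ‖(p : K)‖ ≤ ‖X ^ (p - 1) + (p : K)‖) {ϖ : Kˣ}
    (hϖ : IsUniformizer ϖ) {y : K} (hyP : IsPrincipal y) {s : ℤ} (hy : ‖1 - y‖ = ‖(ϖ : K)‖ ^ s) {a₀ : ℕ}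
    (hlo : ∀ a < a₀, s * (p : ℤ) ^ a * ((p : ℤ) - 1) < absRamificationIdx p K)
    (hhi : (absRamificationIdx p K : ℤ) ≤ s * (p : ℤ) ^ a₀ * ((p : ℤ) - 1)) :
    ‖logSeries y‖ = ‖(ϖ : K)‖ ^ (s * (p : ℤ) ^ a₀ - (absRamificationIdx p K : ℤ) * (a₀ : ℤ)) := by
  rcases hhi.lt_or_eq with hlt | heq
  · exact norm_logSeries_eq_zpow_of_strictTurning p hϖ hyP hy hlo hlt
  · exact norm_logSeries_eq_zpow_of_tie p hNZ hϖ hyP hy hlo heq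

/-! ### §5. The profile under (NZ), every `e` -/

/-- **Every non-zero log-unit has norm `‖ϖ‖^{ν(s)}`** for some `s ≥ 1` and the turning point `a₀` of `s` — under (NZ), for
EVERY `e`. [cite: NeukirchANT1999, Ch. II Prop. (5.5)] -/
theorem exists_norm_unitLog_eq_zpow_of_turning (hNZ : ∀ X : K, ‖(p : K)‖ ≤ ‖X ^ (p - 1) + (p : K)‖) {ϖ : Kˣ}
    (hϖ : IsUniformizer ϖ) {u : K} (hu : ‖u‖ = 1) (h0 : unitLog u ≠ 0) :
    ∃ s : ℤ, 1 ≤ s ∧ ∃ a₀ : ℕ, (∀ a < a₀, s * (p : ℤ) ^ a * ((p : ℤ) - 1) < absRamificationIdx p K) ∧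
      (absRamificationIdx p K : ℤ) ≤ s * (p : ℤ) ^ a₀ * ((p : ℤ) - 1) ∧
      ‖unitLog u‖ = ‖(ϖ : K)‖ ^ (s * (p : ℤ) ^ a₀ - (absRamificationIdx p K : ℤ) * (a₀ : ℤ)) := by
  classical
  have hρ0 : 0 < ‖(ϖ : K)‖ := norm_units_pos ϖ
  have hP : (2 : ℤ) ≤ (p : ℤ) := by exact_mod_cast hp.out.two_le
  obtain ⟨m, hm0, hmp, hmP⟩ := exists_pow_isPrincipal_not_dvd (p := p) hu
  have hlog : unitLog u = ((m : ℕ) : K)⁻¹ * logSeries (u ^ m) := unitLog_eq_inv_mul_logSeries p hm0 hmP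
  have hx : 1 - u ^ m ≠ 0 := by
    intro hx
    apply h0
    rw [hlog, ← sub_eq_zero.mp hx, logSeries_one, mul_zero]
  obtain ⟨s, hs⟩ := hϖ.2 (Units.mk0 (1 - u ^ m) hx)
  rw [Units.val_mk0] at hs
  have hs1 : 1 ≤ s := by
    have h1 : ‖(ϖ : K)‖ ^ s < 1 := hs ▸ hmP
    have := (zpow_lt_one_iff_right_of_lt_one₀ hρ0 hϖ.1).mp h1
    omega
  have hex := exists_le_increment hs1 hP (absRamificationIdx p K)
  refine ⟨s, hs1, Nat.find hex, fun a ha ↦ lt_of_not_ge (Nat.find_min hex ha), Nat.find_spec hex, ?_⟩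
  rw [hlog, norm_mul, norm_inv, norm_natCast_eq_one_of_not_dvd p hmp, inv_one, one_mul]
  exact norm_logSeries_eq_zpow_of_turning p hNZ hϖ hmP hs (fun a ha ↦ lt_of_not_ge (Nat.find_min hex ha))
    (Nat.find_spec hex)

/-- **Every `ν(s)` is attained** (`log_p(1 − ϖˢ)`), under (NZ), with the non-strict turning point. [cite: NeukirchANT1999, Ch. II Prop. (5.5)] -/
theorem norm_unitLog_one_sub_pow_of_turning (hNZ : ∀ X : K, ‖(p : K)‖ ≤ ‖X ^ (p - 1) + (p : K)‖) {ϖ : Kˣ}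
    (hϖ : IsUniformizer ϖ) {s : ℕ} (hs : 1 ≤ s) {a₀ : ℕ}
    (hlo : ∀ a < a₀, (s : ℤ) * (p : ℤ) ^ a * ((p : ℤ) - 1) < absRamificationIdx p K)
    (hhi : (absRamificationIdx p K : ℤ) ≤ (s : ℤ) * (p : ℤ) ^ a₀ * ((p : ℤ) - 1)) :
    ‖unitLog (1 - (ϖ : K) ^ s)‖ =
      ‖(ϖ : K)‖ ^ ((s : ℤ) * (p : ℤ) ^ a₀ - (absRamificationIdx p K : ℤ) * (a₀ : ℤ)) := by
  have hy : ‖1 - (1 - (ϖ : K) ^ s)‖ = ‖(ϖ : K)‖ ^ (s : ℤ) := by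
    rw [sub_sub_cancel, norm_pow, zpow_natCast]
  have hyP : IsPrincipal (1 - (ϖ : K) ^ s) := by
    rw [isPrincipal_iff, hy, zpow_natCast]
    exact pow_lt_one₀ (norm_nonneg _) hϖ.1 (by omega)
  rw [unitLog_of_isPrincipal p hyP]
  exact norm_logSeries_eq_zpow_of_turning p hNZ hϖ hyP hy hlo hhi

/-- **GAP THEOREM under (NZ), every `e`** (same proof as part I's, with the uniform exact norm): `h_s(a₀) < t < ν(s+1)`
(`a₁` the turning point of `s + 1`) ⟹ no log-unit has norm `‖ϖ‖ᵗ`.  Decides the gap cells of the `(p−1) ∣ e_w` rows above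
the first tie level. [cite: NeukirchANT1999, Ch. II Prop. (5.5)] -/
theorem norm_ne_zpow_of_mem_logUnits_of_gap' (hNZ : ∀ X : K, ‖(p : K)‖ ≤ ‖X ^ (p - 1) + (p : K)‖) {ϖ : Kˣ}
    (hϖ : IsUniformizer ϖ) {t s : ℤ} (hs : 1 ≤ s) {a₀ a₁ : ℕ}
    (h1 : s * (p : ℤ) ^ a₀ - (absRamificationIdx p K : ℤ) * (a₀ : ℤ) < t)
    (hlo₁ : ∀ a < a₁, (s + 1) * (p : ℤ) ^ a * ((p : ℤ) - 1) < absRamificationIdx p K)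
    (hhi₁ : (absRamificationIdx p K : ℤ) ≤ (s + 1) * (p : ℤ) ^ a₁ * ((p : ℤ) - 1))
    (h2 : t < (s + 1) * (p : ℤ) ^ a₁ - (absRamificationIdx p K : ℤ) * (a₁ : ℤ))
    {z : K} (hz : z ∈ logUnits K) : ‖z‖ ≠ ‖(ϖ : K)‖ ^ t := by
  intro hzt
  have hρ0 : 0 < ‖(ϖ : K)‖ := norm_units_pos ϖ
  have hP : (2 : ℤ) ≤ (p : ℤ) := by exact_mod_cast hp.out.two_le
  obtain ⟨u, hu, rfl⟩ := mem_logUnits_iff.mp hz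
  have hz0 : unitLog u ≠ 0 := by
    intro h0
    rw [h0, norm_zero] at hzt
    exact (zpow_pos hρ0 t).ne hzt
  obtain ⟨s', hs', a', hlo', hhi', hnorm⟩ := exists_norm_unitLog_eq_zpow_of_turning p hNZ hϖ hu hz0
  have heq : s' * (p : ℤ) ^ a' - (absRamificationIdx p K : ℤ) * (a' : ℤ) = t :=
    zpow_right_injective₀ hρ0 hϖ.1.ne (hnorm.symm.trans hzt)
  rcases le_or_gt s' s with hle | hgt
  · have hmin' := exponent_min (a₀ := a') hs' hP hlo' hhi' a₀
    have hmono := exponent_mono_left p hle a₀ (absRamificationIdx p K : ℤ)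
    linarith
  · have hmono := exponent_mono_left p (show s + 1 ≤ s' by omega) a' (absRamificationIdx p K : ℤ)
    have hmin₁ := exponent_min (a₀ := a₁) (show (1 : ℤ) ≤ s + 1 by omega) hP hlo₁ hhi₁ a'
    linarith

/-- **DECIDED-NEG cell, gap form, under (NZ)** (every `e`): `‖q‖ = ‖ϖ‖ᵐ`, `t = e·ord_p(p*) − m·(n−1)` in a gap ⟹ `q ∉ qⁿ·ℐ_K`.
[cite: NeukirchANT1999, Ch. II Prop. (5.5)] [cite: MochizukiAbsTopIII2015, Def 5.4 (iii) p. 126] -/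
theorem not_mem_pow_smul_logShell_of_gap' (hNZ : ∀ X : K, ‖(p : K)‖ ≤ ‖X ^ (p - 1) + (p : K)‖) {ϖ : Kˣ}
    (hϖ : IsUniformizer ϖ) {q : K} (hq : q ≠ 0) {m : ℤ} (hqm : ‖q‖ = ‖(ϖ : K)‖ ^ m) {n : ℕ} {s : ℤ}
    (hs : 1 ≤ s) {a₀ a₁ : ℕ}
    (h1 : s * (p : ℤ) ^ a₀ - (absRamificationIdx p K : ℤ) * (a₀ : ℤ) <
      (absRamificationIdx p K : ℤ) * ((if p = 2 then 2 else 1 : ℕ) : ℤ) - m * ((n : ℤ) - 1))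
    (hlo₁ : ∀ a < a₁, (s + 1) * (p : ℤ) ^ a * ((p : ℤ) - 1) < absRamificationIdx p K)
    (hhi₁ : (absRamificationIdx p K : ℤ) ≤ (s + 1) * (p : ℤ) ^ a₁ * ((p : ℤ) - 1))
    (h2 : (absRamificationIdx p K : ℤ) * ((if p = 2 then 2 else 1 : ℕ) : ℤ) - m * ((n : ℤ) - 1) <
      (s + 1) * (p : ℤ) ^ a₁ - (absRamificationIdx p K : ℤ) * (a₁ : ℤ)) :
    q ∉ q ^ n • Literature.AnabelianGeometry.AbsoluteAnabelian.logShell (PadicLogOnUnits.ofUnitLog p K) := by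
  rw [mem_pow_smul_logShell_iff p hq]
  intro hmem
  exact norm_ne_zpow_of_mem_logUnits_of_gap' p hNZ hϖ hs h1 hlo₁ hhi₁ h2 hmem (norm_pstar_mul_eq_zpow p hϖ hqm n)

end Analytic

end ValuationProfile

end Literature.IUT.LogVolume

end
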